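import Literature.NumberTheory.CubicFields.UniformitySubringEuler
import Literature.NumberTheory.CubicFields.UniformityMaximalReductionProofs
import HarnessLib

/-!
# The maximal part of the uniformity estimate from the count of cubic fields with `q² ∣ Disc` (BBP Lemma 3.3 ⇒ `MaximalPartBound 3 C`)

`Proofs`-style file (theorems only: no definitions, no named facts). Topic
`Literature/NumberTheory/CubicFields`; continues `UniformitySubringEuler.lean` (the uniform subring bound
`#indexPOrbits g n ≤ e(n)`, `Σ e(n)/n² ≤ K₀`) and `UniformityMaximalReductionProofs.lean` (`maxOrbits`,
`MaximalPartBound c C`, the reduction of BTT Prop. 4.5 to the maximal part).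

Belabas–Bhargava–Pomerance 2010, proof of Lemma 3.4 (published version, as recalled in Taniguchi–Thorne
2013, proof of Lemma 14): "we count the number of maximal cubic rings `R` with discriminant divisible by
`b²`, and then the number of cubic rings `R'` contained in `R` with index divisible by `a` … The count of
maximal cubic rings is `≪ Y 3^{ω(b)}/b²` by Lemma 3.3 of [BBP] in the irreducible case, and the same bound
follows trivially for the reducible case (as there is at most one such ring of any given discriminant)."
Here this becomes the base of the tree's induction (`MaximalPartBound`): the `GL₂(ℤ)`-orbits of forms `f`
with `0 < s·Disc f < X`, `b² ∣ Disc f`, `R(f)` maximal at every prime of `b` are fibred over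
(index `n`, maximal overring `R(g)`) with `(n, b) = 1`, `Disc f = n² Disc g`, hence `b² ∣ Disc g`,
`0 < s·Disc g < X/n²`; the fibres have `≤ e(n)` elements; the maximal `g` with `b² ∣ Disc g` in a window
`Z` are `≤ 2M·3^{ω(b)}·Z/b²` irreducible ones (THE HYPOTHESIS `hM`, the shape of BBP Lemma 3.3 for odd
squarefree `q` and the condition `q² ∣ Disc`) plus `≤ Z/b²` reducible ones (one per discriminant,
`ReducibleMaximalCount`); and `Σ_n e(n)/n² ≤ K₀`:

* `ncard_le_sum_of_fibres` — abstract double counting over a two-step fibration;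
* `ncard_multiples_inWindow_le` — `#{D : 0 < sD < Z, b² ∣ D} ≤ Z/b²`; `ncard_redMaxOrbits_le`;
* `ncard_maxOrbits_le_sum` — **the fibration**: `#maxOrbits B s X b ≤ Σ_{n=1}^{X} e(n)·#MaxFam(s, X/n², b)`;
* `ncard_maxFam_le` — `#MaxFam(s, Z, b) ≤ (2M·3^{#B} + 1)·Z/b²` under `hM`, for `2 ∉ B`;
* **`maximalPartBound_three_of_fieldsBound`** — `hM ⇒ ∃ C, MaximalPartBound 3 C` (dropping `2` from `B`
  at the cost of a factor `4`).

The hypothesis `hM` is implied by BBP Lemma 3.3 (maximal cubic orders not fundamental at the primes of a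
squarefree `q`: `O(3^{ω(q)} X/q²)`; for odd `p`, "not fundamental at `p`" means `p² ∣ D`), proved there by
class field theory; it is NOT proved in this tree.

## References

* K. Belabas, M. Bhargava, C. Pomerance, *Error estimates for the Davenport–Heilbronn theorems*,
  Duke Math. J. 153 (2010) 173–210, Lemmas 3.3, 3.4 [BelabasBhargavaPomerance2010].
* T. Taniguchi, F. Thorne, *Secondary terms in counting functions for cubic fields*, Duke Math. J.
  162 (2013), proof of Lemma 14 [TaniguchiThorne2013].
* M. Bhargava, T. Taniguchi, F. Thorne, *Improved error estimates for the Davenport–Heilbronn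
  theorems*, Math. Ann. 389 (2024) = arXiv:2107.12819, §4.2 Prop. 4.5 [BhargavaTaniguchiThorne2023].
-/

noncomputable section

namespace Literature.NumberTheory.CubicFields

open BinaryCubic RingOfForm Finset

/-! ### Abstract double counting -/

/-- A finite set is counted by its fibres over a finset of `ℕ`. [folklore] -/
theorem ncard_le_sum_ncard_fibre {α : Type*} {S : Set α} (hS : S.Finite) (ψ : α → ℕ) (I : Finset ℕ)
    (hmaps : ∀ a ∈ S, ψ a ∈ I) : S.ncard ≤ ∑ n ∈ I, {a ∈ S | ψ a = n}.ncard := by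
  classical
  rw [Set.ncard_eq_toFinset_card S hS,
    Finset.card_eq_sum_card_fiberwise (f := ψ) (t := I) fun a ha => hmaps a ((Set.Finite.mem_toFinset hS).mp ha)]
  refine Finset.sum_le_sum fun n _ => le_of_eq ?_
  calc (hS.toFinset.filter (fun a => ψ a = n)).card
        = ((hS.toFinset.filter (fun a => ψ a = n) : Finset α) : Set α).ncard := (Set.ncard_coe_finset _).symm
    _ = {a ∈ S | ψ a = n}.ncard := by rw [Finset.coe_filter]; simp only [Set.Finite.mem_toFinset]

/-- **Double counting over a two-step fibration**: if `a ↦ (ψ₁ a, ψ₂ a)` sends the finite `S` into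
`⋃_{n ∈ I} {n} × T n` with fibres over `(n, t)` of size `≤ e n`, then `#S ≤ Σ_{n ∈ I} e n · #(T n)`. [folklore] -/
theorem ncard_le_sum_of_fibres {α β : Type*} {S : Set α} (hS : S.Finite) (ψ₁ : α → ℕ) (ψ₂ : α → β)
    (I : Finset ℕ) (T : ℕ → Set β) (hT : ∀ n ∈ I, (T n).Finite) (e : ℕ → ℕ)
    (hmaps : ∀ a ∈ S, ψ₁ a ∈ I ∧ ψ₂ a ∈ T (ψ₁ a))
    (hfib : ∀ n ∈ I, ∀ t ∈ T n, {a ∈ S | ψ₁ a = n ∧ ψ₂ a = t}.ncard ≤ e n) :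
    S.ncard ≤ ∑ n ∈ I, e n * (T n).ncard := by
  refine (ncard_le_sum_ncard_fibre hS ψ₁ I fun a ha => (hmaps a ha).1).trans (Finset.sum_le_sum fun n hn => ?_)
  refine ncard_le_mul_ncard_of_fibre (hS.subset (Set.sep_subset _ _)) (hT n hn) ψ₂
    (fun a ha => by have h := (hmaps a ha.1).2; rw [ha.2] at h; exact h) (e n) fun t ht => ?_
  have : {a ∈ {a ∈ S | ψ₁ a = n} | ψ₂ a = t} = {a ∈ S | ψ₁ a = n ∧ ψ₂ a = t} := by
    ext a; simp [and_assoc]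
  rw [this]
  exact hfib n hn t ht

/-! ### Discriminants in a window divisible by `b²`, and the reducible maximal orbits -/

/-- **`#{D : 0 < s·D < Z, b² ∣ D} ≤ Z/b²`** (`s = ±1`, `b ≥ 1`): the `D` are `s·b²·j`, `1 ≤ j < Z/b²`. [folklore] -/
theorem ncard_multiples_inWindow_le {s : ℤ} (hs : s = 1 ∨ s = -1) {b : ℕ} (hb : 0 < b) {Z : ℝ} (hZ : 0 ≤ Z) :
    ({D : ℤ | InWindow s Z D ∧ ((b : ℕ) : ℤ) ^ 2 ∣ D}.Finite) ∧
      (({D : ℤ | InWindow s Z D ∧ ((b : ℕ) : ℤ) ^ 2 ∣ D}.ncard : ℕ) : ℝ) ≤ Z / (b : ℝ) ^ 2 := by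
  have hb2 : (0 : ℝ) < (b : ℝ) ^ 2 := by positivity
  have hs1 : s * s = 1 := by rcases hs with rfl | rfl <;> norm_num
  -- the set is the image of `j ↦ s b² j`, `j ∈ Icc 1 J`, `J = #{j ≥ 1 : b² j < Z}`
  set J : ℕ := Nat.floor (Z / (b : ℝ) ^ 2) with hJ
  have hsub : {D : ℤ | InWindow s Z D ∧ ((b : ℕ) : ℤ) ^ 2 ∣ D} ⊆
      (fun j : ℕ => s * (((b : ℕ) : ℤ) ^ 2 * j)) '' (Finset.Icc 1 J : Set ℕ) := by
    rintro D ⟨⟨h0, hZ⟩, ⟨k, hk⟩⟩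
    -- `s D = b² (s k) > 0`, so `s k = j ≥ 1`
    have hsk : 0 < s * k := by
      have : s * D = ((b : ℕ) : ℤ) ^ 2 * (s * k) := by rw [hk]; ring
      rw [this] at h0
      exact pos_of_mul_pos_right h0 (by positivity)
    obtain ⟨j, hj⟩ : ∃ j : ℕ, (j : ℤ) = s * k := ⟨(s * k).toNat, Int.toNat_of_nonneg hsk.le⟩
    refine ⟨j, Finset.mem_coe.mpr (Finset.mem_Icc.mpr ⟨?_, ?_⟩), ?_⟩
    · exact_mod_cast hj ▸ hsk
    · rw [hJ, Nat.le_floor_iff (by positivity), le_div_iff₀ hb2]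
      have h1 : s * D = ((b : ℕ) : ℤ) ^ 2 * j := by rw [hj, hk]; ring
      have h2 : (((b : ℕ) : ℤ) ^ 2 * j : ℤ) < Z := by rw [← h1]; exact hZ
      have h3 : ((j : ℝ) * (b : ℝ) ^ 2) = (((((b : ℕ) : ℤ) ^ 2 * j : ℤ)) : ℝ) := by push_cast; ring
      rw [h3]; exact h2.le
    · change s * (((b : ℕ) : ℤ) ^ 2 * j) = D
      rw [hj, hk]; linear_combination (((b : ℕ) : ℤ) ^ 2 * k) * hs1
  have hfin : ((fun j : ℕ => s * (((b : ℕ) : ℤ) ^ 2 * j)) '' (Finset.Icc 1 J : Set ℕ)).Finite :=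
    (Finset.finite_toSet _).image _
  refine ⟨hfin.subset hsub, ?_⟩
  calc (({D : ℤ | InWindow s Z D ∧ ((b : ℕ) : ℤ) ^ 2 ∣ D}.ncard : ℕ) : ℝ)
      ≤ ((Finset.Icc 1 J : Set ℕ).ncard : ℕ) := by
        exact_mod_cast (Set.ncard_le_ncard hsub hfin).trans (Set.ncard_image_le (Finset.finite_toSet _))
    _ = J := by rw [Set.ncard_coe_finset, Nat.card_Icc]; push_cast; ring
    _ ≤ Z / (b : ℝ) ^ 2 := by rw [hJ]; exact Nat.floor_le (by positivity)

/-- **At most one reducible maximal orbit per discriminant**, so the reducible maximal orbits with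
`0 < s·Disc < Z`, `b² ∣ Disc` number at most `Z/b²`. [folklore] -/
theorem ncard_redMaxOrbits_le {s : ℤ} (hs : s = 1 ∨ s = -1) {b : ℕ} (hb : 0 < b) {Z : ℝ} (hZ : 0 ≤ Z) :
    ({O | ∃ g : BinaryCubic ℤ, O = gl2zOrbit g ∧ IsMaximal g ∧ ¬ g.IsIrreducible ∧ InWindow s Z g.disc ∧
        ((b : ℕ) : ℤ) ^ 2 ∣ g.disc}.Finite) ∧
      (({O | ∃ g : BinaryCubic ℤ, O = gl2zOrbit g ∧ IsMaximal g ∧ ¬ g.IsIrreducible ∧ InWindow s Z g.disc ∧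
        ((b : ℕ) : ℤ) ^ 2 ∣ g.disc}.ncard : ℕ) : ℝ) ≤ Z / (b : ℝ) ^ 2 := by
  obtain ⟨hfin, hle⟩ := ncard_multiples_inWindow_le hs hb hZ
  set R := {O | ∃ g : BinaryCubic ℤ, O = gl2zOrbit g ∧ IsMaximal g ∧ ¬ g.IsIrreducible ∧ InWindow s Z g.disc ∧
        ((b : ℕ) : ℤ) ^ 2 ∣ g.disc}
  -- the discriminant of an orbit (well defined) injects `R` into the set of admissible discriminants
  have hdisc : ∀ O ∈ R, ∃ D : ℤ, (∀ g, O = gl2zOrbit g → g.disc = D) ∧ InWindow s Z D ∧ ((b : ℕ) : ℤ) ^ 2 ∣ D := by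
    rintro O ⟨g, rfl, -, -, hw, hbD⟩
    exact ⟨g.disc, fun g' hg' => (gl2zOrbit_eq_iff.mp hg').disc_eq, hw, hbD⟩
  choose! δ hδ hδw hδb using hdisc
  have hmaps : ∀ O ∈ R, δ O ∈ {D : ℤ | InWindow s Z D ∧ ((b : ℕ) : ℤ) ^ 2 ∣ D} :=
    fun O hO => ⟨hδw O hO, hδb O hO⟩
  have hinj : Set.InjOn δ R := by
    rintro O₁ hO₁ O₂ hO₂ h
    obtain ⟨g₁, rfl, hm₁, hr₁, hw₁, hb₁⟩ := hO₁
    obtain ⟨g₂, rfl, hm₂, hr₂, hw₂, hb₂⟩ := hO₂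
    have h1 := hδ _ ⟨g₁, rfl, hm₁, hr₁, hw₁, hb₁⟩ g₁ rfl
    have h2 := hδ _ ⟨g₂, rfl, hm₂, hr₂, hw₂, hb₂⟩ g₂ rfl
    have h0 : g₁.disc ≠ 0 := by rintro h0; have := hw₁.1; rw [h0, mul_zero] at this; exact lt_irrefl _ this
    exact gl2zOrbit_eq_of_disc_eq hm₁ hr₁ hm₂ hr₂ h0 (h1.trans (h.trans h2.symm))
  refine ⟨Set.Finite.of_injOn hmaps hinj hfin, le_trans ?_ hle⟩
  exact_mod_cast Set.ncard_le_ncard_of_injOn δ hmaps hinj hfin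

/-! ### The fibration of the maximal-at-`B` family over (index, maximal overring) -/

/-- The conditions of `maxOrbits` hold for the representative. [folklore] -/
theorem repOf_of_mem_maxOrbits {B : Finset ℕ} {s : ℤ} {Y : ℝ} {m : ℕ} {O : Set (BinaryCubic ℤ)}
    (hO : O ∈ maxOrbits B s Y m) :
    O = gl2zOrbit (repOf O) ∧ InWindow s Y (repOf O).disc ∧ ((m : ℕ) : ℤ) ^ 2 ∣ (repOf O).disc ∧
      ∀ ℓ ∈ B, (repOf O).MemU ℓ := by
  obtain ⟨f, hO', hw, hm, hB⟩ := hO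
  have he : GL2ZEquiv f (repOf O) := by
    have := gl2zEquiv_repOf f; rwa [← hO'] at this
  rw [show (repOf O).disc = f.disc from he.disc_eq]
  exact ⟨eq_gl2zOrbit_repOf ⟨f, hO'⟩, hw, hm, fun ℓ hℓ => (hB ℓ hℓ).of_gl2zEquiv he⟩

/-- Coprime squares can be cancelled: `(n, b) = 1`, `b² ∣ n² D ⇒ b² ∣ D`. [folklore] -/
theorem sq_dvd_of_sq_dvd_sq_mul {n b : ℕ} (h : Nat.Coprime n b) {D : ℤ} (hD : ((b : ℕ) : ℤ) ^ 2 ∣ (n : ℤ) ^ 2 * D) :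
    ((b : ℕ) : ℤ) ^ 2 ∣ D :=
  (Int.isCoprime_iff_gcd_eq_one.mpr (by simpa [Int.gcd_natCast_natCast] using h.symm)).pow.dvd_of_dvd_mul_left hD

/-- **The fibration**: for a finite set `B` of primes, `b = ∏ B`, `s = ±1`, `X ∈ ℕ`, and any uniform bound
`#indexPOrbits g n ≤ e n` over maximal nondegenerate `g`,
`#maxOrbits B s X b ≤ Σ_{n=1}^{X} e(n) · #{[g] : g maximal, 0 < s·Disc g < X/n², b² ∣ Disc g}`
(each orbit goes to its index and maximal overring; maximality at `ℓ ∈ B` makes the index prime to `b`). [folklore] -/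
theorem ncard_maxOrbits_le_sum {B : Finset ℕ} (hB : ∀ ℓ ∈ B, ℓ.Prime) (s : ℤ) (X : ℕ)
    (e : ℕ → ℕ) (he : ∀ g : BinaryCubic ℤ, IsMaximal g → g.disc ≠ 0 → ∀ n, 0 < n → (indexPOrbits g n).ncard ≤ e n) :
    (maxOrbits B s X (∏ ℓ ∈ B, ℓ)).ncard ≤ ∑ n ∈ Icc 1 X, e n *
      {G | ∃ g : BinaryCubic ℤ, G = gl2zOrbit g ∧ IsMaximal g ∧ InWindow s ((X : ℝ) / (n : ℝ) ^ 2) g.disc ∧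
        (((∏ ℓ ∈ B, ℓ : ℕ)) : ℤ) ^ 2 ∣ g.disc}.ncard := by
  set b : ℕ := ∏ ℓ ∈ B, ℓ with hbdef
  set S := maxOrbits B s X b
  haveI : Nonempty (BinaryCubic ℤ) := ⟨⟨0, 0, 0, 0⟩⟩
  -- the data of the maximal overring of each member
  have hex : ∀ O, O ∈ S → ∃ (g : BinaryCubic ℤ) (n : ℕ), IsMaximal g ∧ g.disc ≠ 0 ∧ 0 < n ∧
      (repOf O).disc = ((n : ℕ) : ℤ) ^ 2 * g.disc ∧ gl2zOrbit (repOf O) ∈ indexPOrbits g n ∧ Nat.Coprime n b := by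
    intro O hO
    obtain ⟨-, hw, -, hU⟩ := repOf_of_mem_maxOrbits hO
    have h0 : (repOf O).disc ≠ 0 := by
      intro h; have := hw.1; rw [h, mul_zero] at this; exact lt_irrefl _ this
    obtain ⟨g, hg, φ, hφ⟩ := exists_isMaximal_overring h0
    have hdet0 := detOnQuot_ne_zero hφ
    refine ⟨g, (detOnQuot φ).natAbs, hg, ?_, Int.natAbs_pos.mpr hdet0, ?_, ⟨repOf O, φ, rfl, hφ, rfl⟩, ?_⟩
    · intro h; apply h0; rw [disc_eq_detOnQuot_sq_mul φ hφ, h, mul_zero]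
    · rw [Int.natAbs_sq]; exact disc_eq_detOnQuot_sq_mul φ hφ
    · rw [hbdef]
      refine Nat.coprime_prod_right_iff.mpr fun ℓ hℓ => (Nat.coprime_comm.mp ((hB ℓ hℓ).coprime_iff_not_dvd.mpr ?_))
      intro hdvd
      exact (memU_iff_forall_not_dvd_detOnQuot (hB ℓ hℓ)).mp (hU ℓ hℓ) g φ hφ (Int.natCast_dvd.mpr hdvd)
  choose! gO nO hmax hg0 hn0 hdisc hmem hcop using hex
  -- where the map lands
  have hmaps : ∀ O ∈ S, nO O ∈ Icc 1 X ∧ gl2zOrbit (gO O) ∈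
      {G | ∃ g : BinaryCubic ℤ, G = gl2zOrbit g ∧ IsMaximal g ∧ InWindow s ((X : ℝ) / (nO O : ℝ) ^ 2) g.disc ∧
        ((b : ℕ) : ℤ) ^ 2 ∣ g.disc} := by
    intro O hO
    obtain ⟨-, hw, hbD, -⟩ := repOf_of_mem_maxOrbits hO
    have hdO := hdisc O hO
    have hwin : InWindow s ((X : ℝ) / (nO O : ℝ) ^ 2) (gO O).disc := by
      have := inWindow_div (pow_pos (hn0 O hO) 2) (D' := (gO O).disc) (by rw [hdO]; push_cast; ring) hw
      simpa using this
    refine ⟨Finset.mem_Icc.mpr ⟨hn0 O hO, ?_⟩, gO O, rfl, hmax O hO, hwin, ?_⟩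
    · -- `n ≤ n² ≤ s·Disc(repOf O) < X`
      have h1 : 0 < s * (gO O).disc := hwin.1
      have h2 : s * (repOf O).disc < X := by exact_mod_cast hw.2
      rw [hdO, mul_left_comm] at h2
      have h3 : ((nO O : ℕ) : ℤ) ^ 2 ≤ ((nO O : ℕ) : ℤ) ^ 2 * (s * (gO O).disc) :=
        le_mul_of_one_le_right (by positivity) h1
      have h4 : ((nO O : ℕ) : ℤ) ≤ ((nO O : ℕ) : ℤ) ^ 2 := by
        have : (1 : ℤ) ≤ nO O := by exact_mod_cast hn0 O hO
        nlinarith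
      have : ((nO O : ℕ) : ℤ) < X := by linarith
      exact_mod_cast this.le
    · rw [hdO] at hbD; exact sq_dvd_of_sq_dvd_sq_mul (hcop O hO) hbD
  refine ncard_le_sum_of_fibres (maxOrbits_finite B s X b) nO (fun O => gl2zOrbit (gO O)) (Icc 1 X) _
    (fun n _ => (maxOrbits_finite ∅ s ((X : ℝ) / (n : ℝ) ^ 2) b).subset ?_) e hmaps fun n hn G hG => ?_
  · rintro G ⟨g, rfl, -, hw, hbg⟩
    exact ⟨g, rfl, hw, hbg, fun ℓ hℓ => absurd hℓ (Finset.notMem_empty ℓ)⟩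
  · -- the fibre over `(n, G)` lies in `indexPOrbits (repOf G) n`
    obtain ⟨g, rfl, hg, hw, -⟩ := hG
    have hn : 0 < n := (Finset.mem_Icc.mp hn).1
    have hGrep : GL2ZEquiv g (repOf (gl2zOrbit g)) := gl2zEquiv_repOf g
    have hg' : IsMaximal (repOf (gl2zOrbit g)) := hg.of_gl2zEquiv hGrep
    have hg0' : (repOf (gl2zOrbit g)).disc ≠ 0 := by
      rw [hGrep.disc_eq]; intro h; have := hw.1; rw [h, mul_zero] at this; exact lt_irrefl _ this
    refine le_trans (Set.ncard_le_ncard ?_ (indexPOrbits_finite' hg0' n)) (he _ hg' hg0' n hn)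
    rintro O ⟨hO, hnO, hGO⟩
    obtain ⟨hrep, -⟩ := repOf_of_mem_maxOrbits hO
    have hequiv : GL2ZEquiv (gO O) (repOf (gl2zOrbit g)) :=
      (gl2zOrbit_eq_iff.mp hGO).trans hGrep
    rw [hrep]
    exact indexPOrbits_subset_of_gl2zEquiv hequiv n (hnO ▸ hmem O hO)

/-! ### The count of the maximal orbits in a window, and `MaximalPartBound 3 C` -/

/-- **`#{[g] maximal : 0 < s·Disc g < Z, b² ∣ Disc g} ≤ (2M·3^{#B} + 1)·Z/b²`** for `b = ∏ B` a product of
ODD primes, under the fields bound `hM` (irreducible `g`: the hypothesis at `⌈Z⌉₊ ≤ 2Z`, empty below `Z = 1`;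
reducible `g`: one orbit per discriminant). [folklore] -/
theorem ncard_maxFam_le {M : ℝ}
    (hM : ∀ q : ℕ, Squarefree q → ¬ 2 ∣ q → ∀ s : ℤ, (s = 1 ∨ s = -1) → ∀ X : ℕ,
      (({O | ∃ f : BinaryCubic ℤ, O = gl2zOrbit f ∧ f.IsIrreducible ∧ IsMaximal f ∧ 0 < s * f.disc ∧
        s * f.disc < X ∧ ((q : ℕ) : ℤ) ^ 2 ∣ f.disc}.ncard : ℕ) : ℝ) ≤ M * 3 ^ q.primeFactors.card * X / (q : ℝ) ^ 2)
    {B : Finset ℕ} (hB : ∀ ℓ ∈ B, ℓ.Prime) (h2 : 2 ∉ B) {s : ℤ} (hs : s = 1 ∨ s = -1) {Z : ℝ} (hZ : 0 ≤ Z) :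
    (({G | ∃ g : BinaryCubic ℤ, G = gl2zOrbit g ∧ IsMaximal g ∧ InWindow s Z g.disc ∧
        (((∏ ℓ ∈ B, ℓ : ℕ)) : ℤ) ^ 2 ∣ g.disc}.ncard : ℕ) : ℝ) ≤
      (2 * M * 3 ^ B.card + 1) * Z / ((∏ ℓ ∈ B, ℓ : ℕ) : ℝ) ^ 2 := by
  set b : ℕ := ∏ ℓ ∈ B, ℓ with hbdef
  have hb0 : 0 < b := Finset.prod_pos fun ℓ hℓ => (hB ℓ hℓ).pos
  have hbsq : Squarefree b := by
    refine Finset.squarefree_prod_of_pairwise_isCoprime (fun ℓ hℓ ℓ' hℓ' hne => ?_) fun ℓ hℓ => (hB ℓ hℓ).prime.squarefree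
    exact Nat.coprime_iff_isRelPrime.mp ((Nat.coprime_primes (hB ℓ hℓ) (hB ℓ' hℓ')).mpr hne)
  have hb2 : ¬ 2 ∣ b := fun h =>
    h2 (by obtain ⟨ℓ, hℓ, h⟩ := (Nat.prime_iff.mp Nat.prime_two).dvd_finsetProd_iff _ |>.mp h
           rwa [(Nat.prime_dvd_prime_iff_eq Nat.prime_two (hB ℓ hℓ)).mp h])
  have hcard : b.primeFactors.card = B.card := by rw [hbdef, Nat.primeFactors_prod hB]
  -- `M ≥ 0` (test the hypothesis at `q = 1`, `X = 1`)
  have hM0 : 0 ≤ M := by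
    have := hM 1 squarefree_one (by norm_num) s hs 1
    simp only [Nat.cast_one, one_pow, div_one, mul_one, Nat.primeFactors_one, Finset.card_empty, pow_zero] at this
    exact (Nat.cast_nonneg _).trans this
  set Irr := {O | ∃ g : BinaryCubic ℤ, O = gl2zOrbit g ∧ IsMaximal g ∧ g.IsIrreducible ∧ InWindow s Z g.disc ∧
        ((b : ℕ) : ℤ) ^ 2 ∣ g.disc}
  set Red := {O | ∃ g : BinaryCubic ℤ, O = gl2zOrbit g ∧ IsMaximal g ∧ ¬ g.IsIrreducible ∧ InWindow s Z g.disc ∧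
        ((b : ℕ) : ℤ) ^ 2 ∣ g.disc}
  obtain ⟨hRedfin, hRed⟩ := ncard_redMaxOrbits_le hs hb0 hZ
  -- the irreducible ones, through the hypothesis at `⌈Z⌉₊`
  have hIrr : (Irr.ncard : ℝ) ≤ 2 * M * 3 ^ B.card * Z / (b : ℝ) ^ 2 ∧ Irr.Finite := by
    rcases lt_or_ge Z 1 with hZ1 | hZ1
    · have hempty : Irr = ∅ := by
        ext O
        simp only [Set.mem_empty_iff_false, iff_false]
        rintro ⟨g, -, -, -, ⟨h0, hZ'⟩, -⟩
        have : (1 : ℝ) ≤ ((s * g.disc : ℤ) : ℝ) := by exact_mod_cast h0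
        linarith
      rw [hempty, Set.ncard_empty, Nat.cast_zero]
      exact ⟨by positivity, Set.finite_empty⟩
    · have hsub : Irr ⊆ {O | ∃ f : BinaryCubic ℤ, O = gl2zOrbit f ∧ f.IsIrreducible ∧ IsMaximal f ∧ 0 < s * f.disc ∧
          s * f.disc < (⌈Z⌉₊ : ℕ) ∧ ((b : ℕ) : ℤ) ^ 2 ∣ f.disc} := by
        rintro O ⟨g, rfl, hg, hirr, ⟨h0, hZ'⟩, hbg⟩
        refine ⟨g, rfl, hirr, hg, h0, ?_, hbg⟩
        have : ((s * g.disc : ℤ) : ℝ) < ((⌈Z⌉₊ : ℕ) : ℝ) := hZ'.trans_le (Nat.le_ceil Z)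
        exact_mod_cast this
      have hfin : {O | ∃ f : BinaryCubic ℤ, O = gl2zOrbit f ∧ f.IsIrreducible ∧ IsMaximal f ∧ 0 < s * f.disc ∧
          s * f.disc < (⌈Z⌉₊ : ℕ) ∧ ((b : ℕ) : ℤ) ^ 2 ∣ f.disc}.Finite := by
        refine (maxOrbits_finite ∅ s ((⌈Z⌉₊ : ℕ) : ℝ) b).subset ?_
        rintro O ⟨f, rfl, -, -, h0, hX, hbf⟩
        exact ⟨f, rfl, ⟨h0, by exact_mod_cast hX⟩, hbf, fun ℓ hℓ => absurd hℓ (Finset.notMem_empty ℓ)⟩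
      have h1 : (Irr.ncard : ℝ) ≤ M * 3 ^ b.primeFactors.card * (⌈Z⌉₊ : ℕ) / (b : ℝ) ^ 2 :=
        le_trans (by exact_mod_cast Set.ncard_le_ncard hsub hfin) (hM b hbsq hb2 s hs ⌈Z⌉₊)
      have h3 : ((⌈Z⌉₊ : ℕ) : ℝ) ≤ 2 * Z := by linarith [Nat.ceil_lt_add_one hZ]
      refine ⟨h1.trans ?_, hfin.subset hsub⟩
      rw [hcard]
      refine div_le_div_of_nonneg_right ?_ (by positivity)
      calc M * 3 ^ B.card * ((⌈Z⌉₊ : ℕ) : ℝ) ≤ M * 3 ^ B.card * (2 * Z) :=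
            mul_le_mul_of_nonneg_left h3 (by positivity)
        _ = 2 * M * 3 ^ B.card * Z := by ring
  obtain ⟨hIrr, hIrrfin⟩ := hIrr
  have hcover : {G | ∃ g : BinaryCubic ℤ, G = gl2zOrbit g ∧ IsMaximal g ∧ InWindow s Z g.disc ∧
      ((b : ℕ) : ℤ) ^ 2 ∣ g.disc} ⊆ Irr ∪ Red := by
    rintro G ⟨g, rfl, hg, hw, hbg⟩
    by_cases hirr : g.IsIrreducible
    exacts [Or.inl ⟨g, rfl, hg, hirr, hw, hbg⟩, Or.inr ⟨g, rfl, hg, hirr, hw, hbg⟩]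
  calc _ ≤ ((Irr ∪ Red).ncard : ℝ) := by exact_mod_cast Set.ncard_le_ncard hcover (hIrrfin.union hRedfin)
    _ ≤ (Irr.ncard : ℝ) + Red.ncard := by exact_mod_cast Set.ncard_union_le Irr Red
    _ ≤ 2 * M * 3 ^ B.card * Z / (b : ℝ) ^ 2 + Z / (b : ℝ) ^ 2 := add_le_add hIrr hRed
    _ = (2 * M * 3 ^ B.card + 1) * Z / (b : ℝ) ^ 2 := by ring

/-- **BBP Lemma 3.3 ⇒ the maximal part with `c = 3`**: under the fields bound `hM` (the shape of
Belabas–Bhargava–Pomerance 2010, Lemma 3.3, for odd squarefree `q` and the condition `q² ∣ Disc`), there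
is `C` with `MaximalPartBound 3 C`: for every finite set of primes `B`, `b = ∏ B`, `s = ±1`, `X ∈ ℕ`,
`#maxOrbits B s X b ≤ C · 3^{#B} · X/b²` (fibration over index and maximal overring, the uniform subring
bound `Σ e(n)/n² ≤ K₀`, and the prime `2` dropped from `B` at the cost of a factor `4`). [folklore] -/
theorem maximalPartBound_three_of_fieldsBound
    (hM : ∃ M : ℝ, ∀ q : ℕ, Squarefree q → ¬ 2 ∣ q → ∀ s : ℤ, (s = 1 ∨ s = -1) → ∀ X : ℕ,
      (({O | ∃ f : BinaryCubic ℤ, O = gl2zOrbit f ∧ f.IsIrreducible ∧ IsMaximal f ∧ 0 < s * f.disc ∧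
        s * f.disc < X ∧ ((q : ℕ) : ℤ) ^ 2 ∣ f.disc}.ncard : ℕ) : ℝ) ≤ M * 3 ^ q.primeFactors.card * X / (q : ℝ) ^ 2) :
    ∃ C : ℝ, MaximalPartBound 3 C := by
  obtain ⟨M, hM⟩ := hM
  obtain ⟨e, K₀, he, hK⟩ := exists_uniform_indexPOrbits_bound
  have hK0 : 0 ≤ K₀ := by simpa using hK 0
  have hM0 : 0 ≤ M := by
    have := hM 1 squarefree_one (by norm_num) 1 (Or.inl rfl) 1
    simp only [Nat.cast_one, one_pow, div_one, mul_one, Nat.primeFactors_one, Finset.card_empty, pow_zero] at this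
    exact (Nat.cast_nonneg _).trans this
  refine ⟨4 * (2 * M + 1) * K₀, fun B hB s hs X => ?_⟩
  -- pass to the odd part `B' = B.erase 2`
  set B' := B.erase 2 with hB'def
  have hB' : ∀ ℓ ∈ B', ℓ.Prime := fun ℓ hℓ => hB ℓ (Finset.mem_of_mem_erase hℓ)
  have h2 : 2 ∉ B' := Finset.notMem_erase 2 B
  set b : ℕ := ∏ ℓ ∈ B, ℓ with hbdef
  set b' : ℕ := ∏ ℓ ∈ B', ℓ with hb'def
  have hb'0 : 0 < b' := Finset.prod_pos fun ℓ hℓ => (hB' ℓ hℓ).pos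
  have hb'b : b' ∣ b := Finset.prod_dvd_prod_of_subset _ _ _ (Finset.erase_subset 2 B)
  have hbb' : (b : ℝ) ≤ 2 * b' := by
    by_cases h2B : 2 ∈ B
    · have : 2 * b' = b := by rw [hbdef, hb'def, hB'def]; exact Finset.mul_prod_erase B (fun ℓ => ℓ) h2B
      exact_mod_cast this.ge
    · have : b' = b := by rw [hb'def, hB'def, Finset.erase_eq_of_notMem h2B]
      rw [← this]; exact_mod_cast Nat.le_mul_of_pos_left b' two_pos
  have hcardle : B'.card ≤ B.card := Finset.card_le_card (Finset.erase_subset 2 B)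
  -- the family only grows
  have hsub : maxOrbits B s X b ⊆ maxOrbits B' s X b' := by
    rintro O ⟨f, hO, hw, hbD, hU⟩
    refine ⟨f, hO, hw, (pow_dvd_pow_of_dvd (Int.natCast_dvd_natCast.mpr hb'b) 2).trans hbD,
      fun ℓ hℓ => hU ℓ (Finset.mem_of_mem_erase hℓ)⟩
  have h1 : ((maxOrbits B s X b).ncard : ℝ) ≤ (maxOrbits B' s X b').ncard := by
    exact_mod_cast Set.ncard_le_ncard hsub (maxOrbits_finite _ _ _ _)
  -- the fibration and the count of the maximal orbits
  have h2' : ((maxOrbits B' s X b').ncard : ℝ) ≤ ∑ n ∈ Icc 1 X, (e n : ℝ) *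
      (({G | ∃ g : BinaryCubic ℤ, G = gl2zOrbit g ∧ IsMaximal g ∧ InWindow s ((X : ℝ) / (n : ℝ) ^ 2) g.disc ∧
        ((b' : ℕ) : ℤ) ^ 2 ∣ g.disc}.ncard : ℕ) : ℝ) := by
    have := ncard_maxOrbits_le_sum hB' s X e he
    exact_mod_cast this
  have h3 : ((maxOrbits B' s X b').ncard : ℝ) ≤
      ∑ n ∈ Icc 1 X, (e n : ℝ) * ((2 * M * 3 ^ B'.card + 1) * ((X : ℝ) / (n : ℝ) ^ 2) / (b' : ℝ) ^ 2) := by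
    refine h2'.trans (Finset.sum_le_sum fun n hn => mul_le_mul_of_nonneg_left ?_ (Nat.cast_nonneg _))
    exact ncard_maxFam_le hM hB' h2 hs (by positivity)
  have h4 : ∑ n ∈ Icc 1 X, (e n : ℝ) * ((2 * M * 3 ^ B'.card + 1) * ((X : ℝ) / (n : ℝ) ^ 2) / (b' : ℝ) ^ 2) =
      (2 * M * 3 ^ B'.card + 1) * (X : ℝ) / (b' : ℝ) ^ 2 * ∑ n ∈ Icc 1 X, (e n : ℝ) / (n : ℝ) ^ 2 := by
    rw [Finset.mul_sum]
    refine Finset.sum_congr rfl fun n hn => ?_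
    have hn : (0 : ℝ) < n := by exact_mod_cast (Finset.mem_Icc.mp hn).1
    field_simp
  have h5 : (2 * M * 3 ^ B'.card + 1) * (X : ℝ) / (b' : ℝ) ^ 2 * ∑ n ∈ Icc 1 X, (e n : ℝ) / (n : ℝ) ^ 2 ≤
      (2 * M * 3 ^ B'.card + 1) * (X : ℝ) / (b' : ℝ) ^ 2 * K₀ :=
    mul_le_mul_of_nonneg_left (hK X) (by positivity)
  -- numerical comparison of the constants
  have h6 : (2 * M * 3 ^ B'.card + 1) * (X : ℝ) / (b' : ℝ) ^ 2 * K₀ ≤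
      4 * (2 * M + 1) * K₀ * 3 ^ B.card * X / (b : ℝ) ^ 2 := by
    have hb0 : (0 : ℝ) < b := by
      have : 0 < b := Finset.prod_pos fun ℓ hℓ => (hB ℓ hℓ).pos
      exact_mod_cast this
    have h3pow : (3 : ℝ) ^ B'.card ≤ 3 ^ B.card := pow_le_pow_right₀ (by norm_num) hcardle
    have h3one : (1 : ℝ) ≤ 3 ^ B.card := one_le_pow₀ (by norm_num)
    have hcoef : 2 * M * 3 ^ B'.card + 1 ≤ (2 * M + 1) * 3 ^ B.card := by nlinarith
    rw [div_mul_eq_mul_div, div_le_div_iff₀ (by positivity) (by positivity)]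
    have hsq : (b : ℝ) ^ 2 ≤ 4 * (b' : ℝ) ^ 2 := by nlinarith
    have hX0 : (0 : ℝ) ≤ X := Nat.cast_nonneg X
    calc (2 * M * 3 ^ B'.card + 1) * (X : ℝ) * K₀ * (b : ℝ) ^ 2
        ≤ ((2 * M + 1) * 3 ^ B.card) * (X : ℝ) * K₀ * (4 * (b' : ℝ) ^ 2) := by
          apply mul_le_mul (mul_le_mul_of_nonneg_right (mul_le_mul_of_nonneg_right hcoef hX0) hK0) hsq
            (by positivity) (by positivity)
      _ = 4 * (2 * M + 1) * K₀ * 3 ^ B.card * X * (b' : ℝ) ^ 2 := by ring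
  exact h1.trans (h3.trans (h4.le.trans (h5.trans h6)))

end Literature.NumberTheory.CubicFields

end
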